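import Summits.AnomalousDissipation.AnomalousDissipation.Theorems.SawtoothPulseCascadeK1LocalisedCascadePhaseBudget
import Summits.AnomalousDissipation.AnomalousDissipation.Theorems.SawtoothPulseCascadeK1LocalisedCascadeKHSheetBandTableB

/-!
# K2 line `bellman-weight` (planner p4, `K2ControlSketch.lean`): stubs S1 and S2 DISCHARGED

prover ad-k1loc-p2 g9 (K2 lane), crux workfile on the dir of stmt-AnomalousDissipation-19491. The two finite-dimensional stubs of p4's
K2 control sketch are consequences of tree theorems (namespace `…Theorems.SawtoothPulseCascade.K2PhaseBudget`, all `--supports 19491`):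
* **S1** `PhaseBudget` (`σ_H + σ_V ≤ σ⋆ = 0.30982` for every class) ← `phaseBudget` (p679117; closed forms p676685, numerics p677422/p677931,
  cells p678664/p678851);
* **S2** `KHSheetAbsolute 8 16` (`qᴴMq(θ) ≤ 16²·qᴴMq(0)` on `[0,8]` for every line `k > 0`, every Bloch phase, every solution of the sheet
  block) ← `sheet_energy_le_sixteen` (p683995; chain p678850 p679625 p680128 p680481 p680650 p681431 p681582 p681777 p682827 p683131 p683134
  p683141 p683801 p683868). The true constant is `13.63`; `B = 15` costs 29 bands with the same generator (`HOME/ad-k1loc-p2/kit-g9/gen_bands.py`).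
`Cruxes/…/K2ControlSketch.lean` is not an importable module on the farm, so its SIX definitions involved (`sigmaH`, `sigmaV`, `PhaseBudget`,
`khField`, `khForm`, `KHSheetAbsolute`) are repeated below CHARACTER-FOR-CHARACTER (commit 922a224b92dd, lines 46–121) in the namespace
`…K2StubsDischarged`; both proofs are definitional unfoldings, so they apply verbatim inside p4's file once it imports the two Theorems modules.
Memo: `K2SheetBlockPropagator.md` §8. Nothing here is K2: S3 (material Bellman transport, `K2MaterialControl.md`) and S4 remain.
-/

open Set

namespace Summit.AnomalousDissipation.AnomalousDissipation.Cruxes.K1LocalisedCascade.K2StubsDischarged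

open Literature.Analysis.FluidPDE.SawtoothCascade
open Summit.AnomalousDissipation.AnomalousDissipation.Theorems.SawtoothPulseCascade.K2PhaseBudget

noncomputable section

/-! ## Verbatim copies of the S1/S2 definitions of `K2ControlSketch.lean` (p4 g14, 922a224b92dd) -/

/-- Modal rate of the H slot for the lattice class `(α,β)`: only the lines `k₁ ∈ {α, 1−α}` can lie in the
Kelvin–Helmholtz band (`a_c = 0.7637…`), the `y`-Bloch phase is `β`. -/
def sigmaH (α β : ℝ) : ℝ := max (sawSigma α β) (sawSigma (1 - α) β)

/-- Modal rate of the V slot for the class `(α,β)`: lines `k₂ ∈ {β, 1−β}`, `x`-Bloch phase `α`. -/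
def sigmaV (α β : ℝ) : ℝ := max (sawSigma β α) (sawSigma (1 - β) α)

/-- **S1. PHASE BUDGET LEMMA.**  For every class the modal rates of the two slots of a phase sum to at most
`σ⋆ = 0.30982`: one Kelvin–Helmholtz e-folding set `e^{γσ⋆}` per PHASE, class-free. -/
def PhaseBudget : Prop :=
  ∀ α ∈ Icc (0 : ℝ) (1 / 2), ∀ β ∈ Icc (0 : ℝ) (1 / 2), sigmaH α β + sigmaV α β ≤ sawSigmaStar

/-- The generator of the 2×2 sheet block of the line `k` with Bloch phase `β` (strain time), tree units:
`X q = ik·(−(π/2+2Σ₀) q₀ − 2S q₁, 2S̄ q₀ + (π/2+2Σ₀) q₁)`. -/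
def khField (k β : ℝ) (q : Fin 2 → ℂ) : Fin 2 → ℂ :=
  let p : ℂ := ((Real.pi / 2 + 2 * sawSigma0 k β : ℝ) : ℂ)
  let S : ℂ := sawS k β
  ![Complex.I * (k : ℂ) * (-p * q 0 - 2 * S * q 1),
    Complex.I * (k : ℂ) * (2 * (starRingEnd ℂ S) * q 0 + p * q 1)]

/-- Kinetic energy of the velocity induced by the sheet pair with amplitudes `q` (per cell, up to a positive
scalar): `qᴴ M q`, `M = −[[Σ₀, S],[S̄, Σ₀]]`. -/
def khForm (k β : ℝ) (q : Fin 2 → ℂ) : ℝ :=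
  -(sawSigma0 k β) * (Complex.normSq (q 0) + Complex.normSq (q 1))
    - 2 * ((starRingEnd ℂ (q 0)) * sawS k β * q 1).re

/-- **S2 (absolute form, the one the per-phase budget consumes).**  `qᴴMq(θ) ≤ B² qᴴMq(0)` on `[0,γ]` for every
line and class. -/
def KHSheetAbsolute (γ B : ℝ) : Prop :=
  ∀ k β : ℝ, 0 < k → ∀ q : ℝ → (Fin 2 → ℂ),
    (∀ θ ∈ Icc (0 : ℝ) γ, HasDerivWithinAt q (khField k β (q θ)) (Icc (0 : ℝ) γ) θ) →
    ∀ θ ∈ Icc (0 : ℝ) γ, khForm k β (q θ) ≤ B ^ 2 * khForm k β (q 0)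

/-! ## The discharges -/

/-- **S1 holds**: the phase budget lemma of the K2 sketch, by the tree theorem `phaseBudget` (p679117). -/
theorem phaseBudget_holds : PhaseBudget := fun α hα β hβ => phaseBudget α hα β hβ

/-- **S2 holds with `B = 16`**: the absolute sheet-block bound of the K2 sketch on the horizon `γ = 8`, by the tree theorem
`sheet_energy_le_sixteen` (p683995); `khField`/`khForm` unfold to its hypotheses by `rfl`. -/
theorem khSheetAbsolute_eight_sixteen : KHSheetAbsolute 8 16 :=
  fun k β hk q hq => sheet_energy_le_sixteen (k := k) (β := β) (q := q) hk rfl rfl rfl rfl hq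

end

end Summit.AnomalousDissipation.AnomalousDissipation.Cruxes.K1LocalisedCascade.K2StubsDischarged
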